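import Literature.NumberTheory.LFunctions.FeketePolyaTablesHigherOrder
import HarnessLib

/-!
# Fekete–Pólya positivity from a table at every order: a kernel-friendly SEQUENTIAL check
# (forced accumulators, values of the induced character computed on the fly)

Topic `Literature/NumberTheory/LFunctions`; namespace `Literature.NumberTheory.LFunctions.FeketePolyaTable`
(sequel of `FeketePolyaTablesHigherOrder.lean`). Small computable definitions (`indVal`, `stepAcc`,
`seqWalk`, `seqCheck`, `accsFrom`, `inducedTable`) and THEOREMS — no named fact, no `sorry`.

`FeketePolyaTable.iterCheck` (previous file) materialises the `k`-fold prefix-sum lists of one period and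
reads their LAST entries first; evaluated by the kernel this forces a chain of `m·k` pending integer
additions at once and exceeds the kernel's recursion depth beyond a few hundred terms. The check
`seqCheck l m k` of this file walks `n = 1, …, m` ONCE (structural recursion on a fuel counter, the
position re-matched to a literal at every step — the discipline of the certificate-replay walks
`NoRealZeroCertificateReplayFast.walk2`), computing the value `χ↑m(n)` on the fly from the length-`q`
table `l` of `χ` (`indVal`: `tableVal l n` if `gcd(n, m) = 1`, else `0`), carrying the `k` accumulators
`(S_1(n), …, S_k(n))` (`stepAcc`: `S_j(n) = S_j(n−1) + S_{j−1}(n)`) and MATCHING the last one against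
`Int.ofNat _` — which both tests `S_k(n) ≥ 0` and forces its evaluation — then tests `S_j(m) ≥ 0`
(`1 ≤ j ≤ k`) on the final state. Measured: `m = 54 285`, `k = 9`, `q = 235` in ≈ 2 min of kernel time;
`m ≤ 2 600` in seconds.

Soundness (`ipsum_nonneg_of_seqCheck`) is the mathematics of the previous file
(`ipsum_nonneg_of_period`: one period suffices at every order, MV §11.2.1 Exercise 7 (f)) applied to the
table `inducedTable l m` of `χ↑m` (a SPECIFICATION list, never evaluated by the kernel); the engines
`lfunction_re_pos_of_induced_table_seq` / `lfunction_ne_zero_of_induced_table_seq` conclude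
`ℜL(σ, χ) > 0` / `L(σ, χ) ≠ 0` for `σ > 0` (Fekete–Pólya at order `k` for `χ↑m`, `FeketePolya1912_holds`;
descent to `χ` by the positive Euler factors, Chowla / Exercise 8). With `m = q` (no induction) the
same engine serves the plain order-`k` criterion.

## References

* H. L. Montgomery, R. C. Vaughan, *Multiplicative Number Theory I*, CUP 2007, §11.2.1 Exercises 7–8.
  [MontgomeryVaughan2007]
* M. Fekete, G. Pólya, *Über ein Problem von Laguerre*, Rend. Circ. Mat. Palermo 34 (1912) 89–120.
  [FeketePolya1912]
* S. Chowla, *Note on Dirichlet's `L`-functions*, Acta Arith. 1 (1935) 113–114. [Chowla1935]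
-/

namespace Literature.NumberTheory.LFunctions

namespace FeketePolyaTable

open Finset Literature.Barriers.RiemannHypothesis

variable (l : List ℤ)

/-! ### Recollections on `ipsum` (the unfolding lemmas of the previous file are private there) -/

/-- `S_0 = tableVal l`. [folklore] -/
private theorem ipsum_zero' (N : ℕ) : ipsum l 0 N = tableVal l N := rfl

/-- `S_{k+1}(0) = 0`. [folklore] -/
private theorem ipsum_succ_zero' (k : ℕ) : ipsum l (k + 1) 0 = 0 := by
  show ∑ n ∈ Icc 1 0, ipsum l k n = 0
  rfl

/-- `S_{k+1}(N+1) = S_{k+1}(N) + S_k(N+1)`. [folklore] -/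
private theorem ipsum_succ_succ' (k N : ℕ) :
    ipsum l (k + 1) (N + 1) = ipsum l (k + 1) N + ipsum l k (N + 1) := by
  show ∑ n ∈ Icc 1 (N + 1), ipsum l k n = (∑ n ∈ Icc 1 N, ipsum l k n) + ipsum l k (N + 1)
  rw [Finset.sum_Icc_succ_top (by omega)]

/-- `S_k` as the tree's `iterSummatory` of `n ↦ tableVal l n` (real-valued). [folklore] -/
private theorem ipsum_cast' (k N : ℕ) :
    (ipsum l k N : ℝ) = iterSummatory (fun n ↦ ((tableVal l n : ℤ) : ℝ)) k N := by
  induction k generalizing N with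
  | zero => simp [ipsum]
  | succ k ih =>
    rw [show ipsum l (k + 1) N = ∑ n ∈ Icc 1 N, ipsum l k n from rfl, iterSummatory_succ, summatory]
    push_cast
    exact Finset.sum_congr rfl fun n _ ↦ ih n

/-! ### The induced table (specification) and its values computed on the fly -/

/-- The value of the induced character `χ↑m` at `n`, from the table `l` of `χ`: `tableVal l n` if
`gcd(n, m) = 1`, else `0`. [cite: MontgomeryVaughan2007, §11.2.1 Exercise 8] -/
def indVal (m n : ℕ) : ℤ := if Nat.gcd n m = 1 then tableVal l n else 0

/-- **The induced table** `inducedTable l m = [χ↑m(0), …, χ↑m(m−1)]` (the specification list; the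
kernel never evaluates it). [cite: MontgomeryVaughan2007, §11.2.1 Exercise 8] -/
def inducedTable (m : ℕ) : List ℤ := (List.range m).map fun n ↦ indVal l m n

/-- Length of the induced table. [folklore] -/
private theorem length_inducedTable (m : ℕ) : (inducedTable l m).length = m := by
  simp [inducedTable]

/-- The induced table passes the induced-table check of the previous file.
[cite: MontgomeryVaughan2007, §11.2.1 Exercise 8] -/
theorem inducedCheck_inducedTable (m : ℕ) : inducedCheck l (inducedTable l m) = true := by
  rw [inducedCheck, List.all_eq_true]
  intro n hn
  rw [length_inducedTable] at hn ⊢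
  have hn' := List.mem_range.mp hn
  rw [decide_eq_true_iff]
  unfold inducedTable
  rw [List.getD_eq_getElem?_getD, List.getElem?_map, List.getElem?_range hn']
  rfl

/-- `indVal` is `m`-periodic when `|l| ∣ m`. [folklore] -/
private theorem indVal_mod {m : ℕ} (hlm : l.length ∣ m) (n : ℕ) : indVal l m (n % m) = indVal l m n := by
  have hg : Nat.gcd (n % m) m = Nat.gcd n m := by rw [← Nat.gcd_rec, Nat.gcd_comm]
  have ht : tableVal l (n % m) = tableVal l n := by unfold tableVal; rw [Nat.mod_mod_of_dvd n hlm]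
  unfold indVal
  by_cases hc : Nat.gcd n m = 1
  · rw [if_pos hc, if_pos (hg.trans hc), ht]
  · rw [if_neg hc, if_neg (fun h ↦ hc (hg.symm.trans h))]

/-- Values of the induced table: `tableVal (inducedTable l m) n = indVal l m n` (`m > 0`, `|l| ∣ m`).
[cite: MontgomeryVaughan2007, §11.2.1 Exercise 8] -/
theorem tableVal_inducedTable {m : ℕ} (hm : 0 < m) (hlm : l.length ∣ m) (n : ℕ) :
    tableVal (inducedTable l m) n = indVal l m n := by
  rw [tableVal, length_inducedTable]
  unfold inducedTable
  rw [List.getD_eq_getElem?_getD, List.getElem?_map, List.getElem?_range (Nat.mod_lt n hm)]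
  exact indVal_mod l hlm n

/-! ### The kernel walk -/

/-- One step of the accumulators: from `(S_1(n−1), …, S_k(n−1))` and `x = S_0(n)` to
`(S_1(n), …, S_k(n))`, `S_j(n) = S_j(n−1) + S_{j−1}(n)`. [folklore] -/
def stepAcc : List ℤ → ℤ → List ℤ
  | [], _ => []
  | s :: rest, x =>
    let y := s + x
    y :: stepAcc rest y

/-- **The walk**: `seqWalk l m fuel n st` processes the positions `n+1, …, n+fuel` from the accumulator
state `st` at position `n`; at each position the last accumulator `S_k` is matched against `Int.ofNat _`
(test `≥ 0` AND evaluation), the position is re-matched to a literal; at the end every accumulator is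
tested `≥ 0`. [cite: MontgomeryVaughan2007, §11.2.1 Exercise 7 (f)] -/
def seqWalk (m : ℕ) : ℕ → ℕ → List ℤ → Bool
  | 0, _, st => st.all fun s ↦ decide (0 ≤ s)
  | fuel + 1, n, st =>
    let st' := stepAcc st (indVal l m (n + 1))
    match st'.getLastD 0 with
    | Int.negSucc _ => false
    | Int.ofNat _ =>
      match n + 1 with
      | 0 => false
      | n' + 1 => seqWalk m fuel (n' + 1) st'

/-- **The sequential kernel check at order `k` for the induced modulus `m`**: walk `n = 1, …, m` from
`k` zero accumulators. [cite: MontgomeryVaughan2007, §11.2.1 Exercise 7 (f)] -/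
def seqCheck (m k : ℕ) : Bool := seqWalk l m m 0 (List.replicate k 0)

/-- Unfolding one step of the walk. [folklore] -/
private theorem seqWalk_succ (m fuel n : ℕ) (st : List ℤ) (h : seqWalk l m (fuel + 1) n st = true) :
    0 ≤ (stepAcc st (indVal l m (n + 1))).getLastD 0 ∧
      seqWalk l m fuel (n + 1) (stepAcc st (indVal l m (n + 1))) = true := by
  rw [seqWalk] at h
  simp only at h
  generalize hz : (stepAcc st (indVal l m (n + 1))).getLastD 0 = z at h
  cases z with
  | negSucc a => exact absurd h Bool.false_ne_true
  | ofNat a => exact ⟨Int.natCast_nonneg a, h⟩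

/-! ### The accumulator invariant -/

/-- The accumulator list `[S_{j+1}(n), …, S_{j+k}(n)]` of a table `L`. [folklore] -/
def accsFrom (L : List ℤ) (j k n : ℕ) : List ℤ := (List.range k).map fun i ↦ ipsum L (j + 1 + i) n

/-- `accsFrom` at `k + 1`: head `S_{j+1}(n)`, tail `accsFrom (j+1) k n`. [folklore] -/
private theorem accsFrom_succ (L : List ℤ) (j k n : ℕ) :
    accsFrom L j (k + 1) n = ipsum L (j + 1) n :: accsFrom L (j + 1) k n := by
  unfold accsFrom
  rw [List.range_succ_eq_map, List.map_cons, List.map_map]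
  congr 1
  refine List.map_congr_left fun i _ ↦ ?_
  simp only [Function.comp_apply]
  congr 1
  omega

/-- The initial state: `S_j(0) = 0`. [folklore] -/
private theorem accsFrom_zero_right (L : List ℤ) (k : ℕ) : accsFrom L 0 k 0 = List.replicate k 0 := by
  unfold accsFrom
  rw [show (fun i : ℕ ↦ ipsum L (0 + 1 + i) 0) = fun _ ↦ (0 : ℤ) from funext fun i ↦ by
    rw [show 0 + 1 + i = i + 1 by omega, ipsum_succ_zero'], List.map_const', List.length_range]

/-- **One step is one step**: `stepAcc [S_{j+1}(n), …] S_j(n+1) = [S_{j+1}(n+1), …]`. [folklore] -/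
private theorem stepAcc_accsFrom (L : List ℤ) (k : ℕ) : ∀ j n : ℕ,
    stepAcc (accsFrom L j k n) (ipsum L j (n + 1)) = accsFrom L j k (n + 1) := by
  induction k with
  | zero => intro j n; rfl
  | succ k ih =>
    intro j n
    rw [accsFrom_succ, accsFrom_succ, stepAcc]
    have h1 : ipsum L (j + 1) n + ipsum L j (n + 1) = ipsum L (j + 1) (n + 1) := by
      rw [ipsum_succ_succ']
    simp only [h1, ih (j + 1) n]

/-- Last accumulator: `S_{j+k}(n)` (`k ≥ 1`). [folklore] -/
private theorem getLastD_accsFrom (L : List ℤ) (j k n : ℕ) (hk : 1 ≤ k) :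
    (accsFrom L j k n).getLastD 0 = ipsum L (j + k) n := by
  obtain ⟨k, rfl⟩ : ∃ k', k = k' + 1 := ⟨k - 1, by omega⟩
  unfold accsFrom
  rw [List.range_succ, List.map_append, List.map_singleton, List.getLastD_eq_getLast?,
    List.getLast?_concat]
  simp only [Option.getD_some]
  congr 1
  omega

/-- **Soundness of the walk** from position `n` with `c` positions to go, for `L = inducedTable l m`.
[cite: MontgomeryVaughan2007, §11.2.1 Exercise 7 (f)] -/
private theorem seqWalk_sound {m : ℕ} (hm : 0 < m) (hlm : l.length ∣ m) {k : ℕ} (hk : 1 ≤ k) :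
    ∀ c n : ℕ, seqWalk l m c n (accsFrom (inducedTable l m) 0 k n) = true →
      (∀ N, n < N → N ≤ n + c → 0 ≤ ipsum (inducedTable l m) k N) ∧
        (∀ j, 1 ≤ j → j ≤ k → 0 ≤ ipsum (inducedTable l m) j (n + c)) := by
  set L := inducedTable l m with hL
  intro c
  induction c with
  | zero =>
    intro n h
    have h' : ∀ s ∈ accsFrom L 0 k n, 0 ≤ s := by
      rw [seqWalk, List.all_eq_true] at h
      exact fun s hs ↦ of_decide_eq_true (h s hs)
    refine ⟨fun N h1 h2 ↦ by omega, fun j hj hjk ↦ ?_⟩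
    rw [Nat.add_zero]
    apply h'
    unfold accsFrom
    exact List.mem_map.mpr ⟨j - 1, List.mem_range.mpr (by omega), by congr 1; omega⟩
  | succ c ih =>
    intro n h
    obtain ⟨h1, h2⟩ := seqWalk_succ l m c n _ h
    have hval : indVal l m (n + 1) = ipsum L 0 (n + 1) := by
      rw [ipsum_zero', hL, tableVal_inducedTable l hm hlm]
    have hstep : stepAcc (accsFrom L 0 k n) (indVal l m (n + 1)) = accsFrom L 0 k (n + 1) := by
      rw [hval]
      exact stepAcc_accsFrom L k 0 n
    rw [hstep] at h1 h2
    have h1' : 0 ≤ ipsum L k (n + 1) := by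
      rwa [getLastD_accsFrom L 0 k (n + 1) hk, Nat.zero_add] at h1
    obtain ⟨hA, hB⟩ := ih (n + 1) h2
    refine ⟨fun N hN1 hN2 ↦ ?_, fun j hj hjk ↦ ?_⟩
    · rcases Nat.lt_or_ge (n + 1) N with hlt | hge
      · exact hA N hlt (by omega)
      · have : N = n + 1 := by omega
        rw [this]; exact h1'
    · rw [show n + (c + 1) = n + 1 + c by omega]
      exact hB j hj hjk

/-- **Soundness of the sequential check**: `seqCheck l m k = true` (`m > 0`, `|l| ∣ m`, `k ≥ 1`) gives
`S_k(N, χ↑m) ≥ 0` for every `N ≥ 1` (for the table `inducedTable l m`).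
[cite: MontgomeryVaughan2007, §11.2.1 Exercise 7 (f)] -/
theorem ipsum_nonneg_of_seqCheck {m : ℕ} (hm : 0 < m) (hlm : l.length ∣ m) {k : ℕ} (hk : 1 ≤ k)
    (h : seqCheck l m k = true) : ∀ N, 1 ≤ N → 0 ≤ ipsum (inducedTable l m) k N := by
  rw [seqCheck, ← accsFrom_zero_right (inducedTable l m)] at h
  obtain ⟨hA, hB⟩ := seqWalk_sound l hm hlm hk m 0 h
  simp only [Nat.zero_add] at hA hB
  have hlen : 0 < (inducedTable l m).length := by rw [length_inducedTable]; exact hm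
  refine ipsum_nonneg_of_period (inducedTable l m) hlen (fun j hj hjk ↦ ?_) (fun N hN hNm ↦ ?_)
  · rw [length_inducedTable]; exact hB j hj hjk
  · rw [length_inducedTable] at hNm; exact hA N hN hNm

/-- `S_k(N, n ↦ χ↑m(n)) ≥ 0` for all `N ≥ 1` from the sequential check, in the tree's `iterSummatory`
currency. [cite: MontgomeryVaughan2007, §11.2.1 Exercise 7 (f)] -/
theorem iterSummatory_inducedTable_nonneg_of_seqCheck {m : ℕ} (hm : 0 < m) (hlm : l.length ∣ m)
    {k : ℕ} (hk : 1 ≤ k) (h : seqCheck l m k = true) (N : ℕ) (hN : 1 ≤ N) :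
    0 ≤ iterSummatory (fun n ↦ ((tableVal (inducedTable l m) n : ℤ) : ℝ)) k N := by
  rw [← ipsum_cast']
  exact_mod_cast ipsum_nonneg_of_seqCheck l hm hlm hk h N hN

/-! ### The engines -/

variable {q : ℕ} (χ : DirichletCharacter ℂ q)

/-- **Order `k` along an induced character, sequential check.** `χ ≠ χ₀` quadratic mod `q` with
table `l` (`χ(n) = tableVal l n`, `|l| = q`), `q ∣ m`, `k ≥ 1`, `seqCheck l m k` ⇒ `ℜL(σ, χ) > 0` for
every `σ > 0`: Fekete–Pólya at order `k` for `χ↑m` (`FeketePolya1912_holds`), then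
`L(σ, χ↑m) = L(σ, χ)·∏_{p ∣ m}(1 − χ(p)p^{−σ})` with positive Euler factors
(`re_LFunction_changeLevel_ofReal`, `eulerFactors_pos`). With `m = q` this is the plain order-`k`
criterion for `χ`. [cite: MontgomeryVaughan2007, §11.2.1 Exercises 7 (g), 8] [cite: FeketePolya1912]
[cite: Chowla1935] -/
theorem lfunction_re_pos_of_induced_table_seq [NeZero q] {m : ℕ} [NeZero m] (hχ : χ ≠ 1)
    (hquad : χ.IsQuadratic) (hqm : q ∣ m) (hlq : l.length = q)
    (hv : ∀ n : ℕ, χ (n : ZMod q) = ((tableVal l n : ℤ) : ℂ)) {k : ℕ} (hk : 1 ≤ k)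
    (h : seqCheck l m k = true) {σ : ℝ} (hσ : 0 < σ) : 0 < (χ.LFunction (σ : ℂ)).re := by
  set ψ := DirichletCharacter.changeLevel hqm χ with hψ
  have hm : 0 < m := Nat.pos_of_ne_zero (NeZero.ne m)
  have hlm : l.length ∣ m := by rw [hlq]; exact hqm
  have hψ1 : ψ ≠ 1 := fun h' ↦ hχ ((DirichletCharacter.changeLevel_eq_one_iff hqm).mp h')
  have hsq : χ ^ 2 = 1 := MulChar.isQuadratic_iff_sq_eq_one.mp hquad
  have hψsq : ψ ^ 2 = 1 := by rw [hψ, ← map_pow, hsq, map_one]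
  have hψquad : ψ.IsQuadratic := MulChar.isQuadratic_iff_sq_eq_one.mpr hψsq
  have hLm : (inducedTable l m).length = m := length_inducedTable l m
  have hf : (fun n : ℕ ↦ (ψ (n : ZMod m)).re) = fun n ↦ ((tableVal (inducedTable l m) n : ℤ) : ℝ) := by
    funext n
    exact re_changeLevel_eq_tableVal l χ hqm (inducedTable l m) hlq hLm hv (inducedCheck_inducedTable l m) n
  have hψpos : 0 < (ψ.LFunction (σ : ℂ)).re := by
    refine FeketePolya1912_holds m ψ hψ1 hψquad k hk (fun N hN ↦ ?_) σ hσ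
    rw [hf]
    exact iterSummatory_inducedTable_nonneg_of_seqCheck l hm hlm hk h N hN
  rw [hψ, re_LFunction_changeLevel_ofReal hqm χ hχ hsq σ] at hψpos
  exact pos_of_mul_pos_left hψpos (eulerFactors_pos m χ hsq hσ).le

/-- Order `k` along an induced character, sequential check, non-vanishing form: `L(σ, χ) ≠ 0` for
`σ > 0`. [cite: MontgomeryVaughan2007, §11.2.1 Exercises 7 (g), 8] -/
theorem lfunction_ne_zero_of_induced_table_seq [NeZero q] {m : ℕ} [NeZero m] (hχ : χ ≠ 1)
    (hquad : χ.IsQuadratic) (hqm : q ∣ m) (hlq : l.length = q)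
    (hv : ∀ n : ℕ, χ (n : ZMod q) = ((tableVal l n : ℤ) : ℂ)) {k : ℕ} (hk : 1 ≤ k)
    (h : seqCheck l m k = true) {σ : ℝ} (hσ : 0 < σ) : χ.LFunction (σ : ℂ) ≠ 0 := by
  intro h0
  have := lfunction_re_pos_of_induced_table_seq l χ hχ hquad hqm hlq hv hk h hσ
  rw [h0, Complex.zero_re] at this
  exact lt_irrefl _ this

/-- **The form used by the range files** (statement shape of `NoRealZeroUpTo`): for a primitive
quadratic `χ` mod `q ≥ 2` with table `l`, a witness `(m, k)` with `q ∣ m`, `k ≥ 1` and `seqCheck l m k`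
gives `L(σ, χ) ≠ 0` for all `σ ∈ (0, 1)`. [cite: MontgomeryVaughan2007, §11.2.1 Exercises 7 (g), 8] -/
theorem good_of_seqCheck [NeZero q] (hq : 2 ≤ q) {m : ℕ} [NeZero m] (hqm : q ∣ m) (hlq : l.length = q)
    {k : ℕ} (hk : 1 ≤ k) (h : seqCheck l m k = true)
    (hv : ∀ χ : DirichletCharacter ℂ q, χ.IsQuadratic → χ.IsPrimitive →
      ∀ n : ℕ, χ (n : ZMod q) = ((tableVal l n : ℤ) : ℂ)) :
    ∀ χ : DirichletCharacter ℂ q, χ.IsQuadratic → χ.IsPrimitive →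
      ∀ σ : ℝ, 0 < σ → σ < 1 → χ.LFunction σ ≠ 0 :=
  fun χ hquad hprim _ hσ _ ↦ lfunction_ne_zero_of_induced_table_seq l χ
    (SiegelZeroQuality.ne_one_of_isPrimitive hprim hq) hquad hqm hlq (hv χ hquad hprim) hk h hσ

end FeketePolyaTable

end Literature.NumberTheory.LFunctions
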